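import Summits.Ventures.PercRepro.ProfilePointedSplit

/-!
# PercRepro — THE CAPTURED PROFILE `κ` AND THE STRENGTHENING (A1κ) OF THE `p`-AVOIDING HALF (A1)
(p10, gen 15; `proofs/P10-AVFULL.md` §23)

For a finite matroid `M` on `N = #E` elements and a point `p ∈ E`, the `p`-avoiding bi-independent `k`-sets split by
whether they CAPTURE `p`: `κ_k := #{X ∈ BI_k : p ∉ X, p ∈ cl X}` (`capCount`) and `c^p_k = #{X ∈ BI_k : p ∉ X, p ∉ cl X}`
(`extCount`), so `out_k = κ_k + c^p_k` (`capCount_add_extCount`).  The `p`-avoiding half (A1) of the pointed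
conjecture (`PointedRowOut`, gen 14) is implied by the cleaner statement on the captured family alone,

  (A1κ)  `(N − k − 1) · κ_k ≤ k · κ_{k+1}`   for `2k + 2 ≤ N`            (`PointedRowCap`, NOT asserted):

«Theorem A with the constants `(N − k − 1, k)` for the captured sets» — at a parallel pair `{p, e}` it IS Theorem A at level
`k − 1` for the minor `(M ∖ p) / e` on `N − 2` elements (the tight instances), at a coloop it is void (`κ = 0`).  Census
(gen 15, `mining/p10/g15/`): 0 violations on every matroid with ≤ 9 elements (6,872,108 level instances; tight in exactly
24 at `n = 9`, all parallel pairs), on the ≤ 9 catalogue ⊕ up to 30 / 20 coloops (329,619,020 instances), on random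
binary / ternary / GF(5) / graphic / sparse-paving matroids on up to 20 elements and their coloop extensions, and on the
`Θ_t + chord ⊕ coloops` family (`t ≤ 7`, `c ≤ 80`) that refuted (A2).  Its consequences, all proved here:

* (A1κ) ⟹ STEP: `κ_k ≤ κ_{k+1}` for `2k + 2 ≤ N` (`CapStep`; `capStep_of_pointedRowCap`, arithmetic);
* (A1κ) ⟹ (A1), modulo the named fact (Theorem A for `M / p`: `c^p_k = P_k(M / p)` is monotone up to the middle)
  (`pointedRowOut_of_pointedRowCap_of_fact`);
* (SYM) `κ_k ≤ κ_{N−k}` for `2k < N` (`CapSym`) ⟹ (C1′) «the captured `p`-avoiding sets have average size ≥ N/2»,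
  `N · Σ_k κ_k ≤ 2 · Σ_k k · κ_k` (`CapLimit`; `capLimit_of_capSym`, the pairing `k ↔ N − k`).
(C1′) is the coloop limit of (A1κ) and of (A1) (paper, §23); nothing here asserts (A1κ), STEP, (SYM), (C1′) or (A1).
-/

open scoped Matroid

namespace PercRepro.Cogirth

open Finset ThmH Skew

variable {α : Type} [DecidableEq α] {M : Matroid α} [M.Finite]

/-- `κ_k`: the bi-independent `k`-sets avoiding the point `p` and capturing it (`p ∈ cl X`). -/
noncomputable def capCount (M : Matroid α) [M.Finite] (k : ℕ) (p : α) : ℕ :=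
  ((biIndepSets M k).filter (fun X => p ∉ X ∧ p ∈ clF M X)).card

/-- `out_k = κ_k + c^p_k`: a `p`-avoiding bi-independent set either captures `p` or extends by `p`. -/
theorem capCount_add_extCount (k : ℕ) {p : α} (hp : p ∈ gr M) :
    capCount M k p + extCount M k p = outCount M k p := by
  unfold capCount extCount outCount
  have h1 : (biIndepSets M k).filter (fun X => p ∉ X ∧ insert p X ∈ biIndepSets M (k + 1)) =
      (biIndepSets M k).filter (fun X => p ∉ X ∧ p ∉ clF M X) := by
    apply filter_congr
    intro X hX
    constructor
    · rintro ⟨hpX, hins⟩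
      exact ⟨hpX, (insert_mem_biIndepSets_iff hX hp hpX).1 hins⟩
    · rintro ⟨hpX, hcl⟩
      exact ⟨hpX, (insert_mem_biIndepSets_iff hX hp hpX).2 hcl⟩
  rw [h1]
  have h2 := card_filter_add_card_filter_not (s := (biIndepSets M k).filter (fun X => p ∉ X))
    (fun X => p ∈ clF M X)
  rw [filter_filter, filter_filter] at h2
  exact h2

/-- **(A1κ), THEOREM A FOR THE CAPTURED FAMILY (NOT asserted)**: for every finite matroid on `α`, every point `p` and
every level `k` with `2k + 2 ≤ #E`, `(N − k − 1) · κ_k ≤ k · κ_{k+1}`. -/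
def PointedRowCap (α : Type) [DecidableEq α] : Prop :=
  ∀ (M : Matroid α) [M.Finite] (p : α) (k : ℕ), p ∈ gr M → 2 * k + 2 ≤ (gr M).card →
    ((gr M).card - k - 1) * capCount M k p ≤ k * capCount M (k + 1) p

/-- **STEP (NOT asserted)**: the captured profile is non-decreasing up to the middle, `κ_k ≤ κ_{k+1}` for
`2k + 2 ≤ #E`. -/
def CapStep (α : Type) [DecidableEq α] : Prop :=
  ∀ (M : Matroid α) [M.Finite] (p : α) (k : ℕ), p ∈ gr M → 2 * k + 2 ≤ (gr M).card →
    capCount M k p ≤ capCount M (k + 1) p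

/-- **(SYM) (NOT asserted)**: the captured profile is dominated by its mirror, `κ_k ≤ κ_{N−k}` for `2k < #E`. -/
def CapSym (α : Type) [DecidableEq α] : Prop :=
  ∀ (M : Matroid α) [M.Finite] (p : α) (k : ℕ), p ∈ gr M → 2 * k < (gr M).card →
    capCount M k p ≤ capCount M ((gr M).card - k) p

/-- **(C1′) (NOT asserted)**: the captured `p`-avoiding bi-independent sets have average size at least `N / 2`,
`N · Σ_k κ_k ≤ 2 · Σ_k k · κ_k` — the coloop limit of (A1) and of (A1κ). -/
def CapLimit (α : Type) [DecidableEq α] : Prop :=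
  ∀ (M : Matroid α) [M.Finite] (p : α), p ∈ gr M →
    (gr M).card * ∑ k ∈ range ((gr M).card + 1), capCount M k p ≤
      2 * ∑ k ∈ range ((gr M).card + 1), k * capCount M k p

/-- (A1κ) ⟹ STEP: below the middle `N − k − 1 ≥ k + 1`, so `k · κ_k ≤ (N − k − 1) · κ_k ≤ k · κ_{k+1}`. -/
theorem capStep_of_pointedRowCap (h : PointedRowCap α) : CapStep α := by
  intro M _ p k hp hk
  have h1 := h M p k hp hk
  rcases Nat.eq_zero_or_pos k with rfl | hk0
  · have h0 : capCount M 0 p = 0 := by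
      rcases Nat.eq_zero_or_pos (capCount M 0 p) with h0 | h0
      · exact h0
      · exfalso
        have h2 : 0 < ((gr M).card - 0 - 1) * capCount M 0 p := Nat.mul_pos (by omega) h0
        omega
    rw [h0]
    exact Nat.zero_le _
  · apply Nat.le_of_mul_le_mul_left (c := k) _ hk0
    calc k * capCount M k p ≤ ((gr M).card - k - 1) * capCount M k p :=
          Nat.mul_le_mul_right _ (by omega)
      _ ≤ k * capCount M (k + 1) p := h1

/-- A loop extends no bi-independent set: `c^p_k = 0` when `{p}` is dependent. -/
theorem extCount_eq_zero_of_not_indep {p : α} (hp : ¬ M.Indep {p}) (k : ℕ) : extCount M k p = 0 := by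
  unfold extCount
  rw [card_eq_zero, filter_eq_empty_iff]
  intro X _ hX
  obtain ⟨hpX, hins⟩ := hX
  rw [mem_biIndepSets] at hins
  apply hp
  have h1 : rk M {p} = ({p} : Finset α).card :=
    rk_eq_card_of_subset_of_rk_eq_card (singleton_subset_iff.2 (mem_insert_self p X)) hins.2.2.1
  have h2 := indep_of_rk_eq_card' h1
  simpa using h2

/-- Under the named fact, `c^p_k = P_k(M / p)` is non-decreasing up to the middle: `c^p_k ≤ c^p_{k+1}` for
`2k + 2 ≤ #E` (Theorem A for the contraction on `N − 1` elements; at `2k + 2 = N` by the symmetry `P_k = P_{k+1}`). -/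
theorem extCount_mono_of_fact (hfact : BiIndepDensityLogConcave α) (M : Matroid α) [M.Finite] {p : α}
    (hp : p ∈ gr M) (k : ℕ) (hk : 2 * k + 2 ≤ (gr M).card) :
    extCount M k p ≤ extCount M (k + 1) p := by
  by_cases hp1 : M.Indep {p}
  · rw [extCount_eq_card_biIndepSets_contract hp1 k, extCount_eq_card_biIndepSets_contract hp1 (k + 1)]
    have hN : (gr (M ／ ({p} : Set α))).card = (gr M).card - 1 := by
      rw [gr_contract', card_erase_of_mem hp]
    obtain ⟨m, hm⟩ := Nat.exists_eq_add_of_le hk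
    rcases Nat.eq_zero_or_pos m with rfl | hm1
    · have hs := card_biIndepSets_symm (M ／ ({p} : Set α)) (k := k) (by rw [hN]; omega)
      rw [hN, hm, show 2 * k + 2 + 0 - 1 - k = k + 1 by omega] at hs
      rw [hs]
    · have h := biIndepDensity_mono_of_fact hfact (M ／ ({p} : Set α)) k (by rw [hN]; omega)
      rw [hN, hm, show 2 * k + 2 + m - 1 - k = k + 1 + m by omega] at h
      apply Nat.le_of_mul_le_mul_left (c := k + 1) _ (by omega)
      calc (k + 1) * (biIndepSets (M ／ ({p} : Set α)) k).card
          ≤ (k + 1 + m) * (biIndepSets (M ／ ({p} : Set α)) k).card :=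
            Nat.mul_le_mul_right _ (by omega)
        _ ≤ (k + 1) * (biIndepSets (M ／ ({p} : Set α)) (k + 1)).card := h
  · rw [extCount_eq_zero_of_not_indep hp1 k]
    exact Nat.zero_le _

/-- **(A1κ) ⟹ (A1)** (modulo the named fact): with `out = κ + c^p` and `c^p_k ≤ c^p_{k+1}`,
`(N − k − 1)(κ_k + c_k) ≤ k κ_{k+1} + k c_{k+1} + (N − 2k − 1) c_k`. -/
theorem pointedRowOut_of_pointedRowCap_of_fact (hfact : BiIndepDensityLogConcave α) (h : PointedRowCap α) :
    PointedRowOut α := by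
  intro M _ p k hp hk
  have h1 := h M p k hp hk
  have hc := extCount_mono_of_fact hfact M hp k hk
  rw [← capCount_add_extCount k hp, ← capCount_add_extCount (k + 1) hp]
  obtain ⟨m, hm⟩ := Nat.exists_eq_add_of_le hk
  rw [hm, show 2 * k + 2 + m - k - 1 = k + 1 + m by omega] at h1
  rw [hm, show 2 * k + 2 + m - k - 1 = k + 1 + m by omega,
    show 2 * k + 2 + m - 2 * k - 1 = m + 1 by omega]
  generalize capCount M k p = a at h1 ⊢
  generalize capCount M (k + 1) p = b at h1 ⊢
  generalize extCount M k p = c at hc ⊢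
  generalize extCount M (k + 1) p = d at hc ⊢
  calc (k + 1 + m) * (a + c) = (k + 1 + m) * a + k * c + (m + 1) * c := by ring
    _ ≤ k * b + k * d + (m + 1) * c :=
        Nat.add_le_add_right (Nat.add_le_add h1 (Nat.mul_le_mul_left k hc)) _
    _ = k * (b + d) + (m + 1) * c := by ring

/-- The signed first moment of the captured profile, paired with its mirror: for a sequence `f` on `0 … N` with
`f k ≤ f (N − k)` whenever `2k < N`, `Σ_k (2k − N) · f k ≥ 0` (over `ℤ`). -/
theorem sum_mirror_nonneg (N : ℕ) (f : ℕ → ℕ) (hf : ∀ k, 2 * k < N → f k ≤ f (N - k)) :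
    0 ≤ ∑ k ∈ range (N + 1), ((2 * (k : ℤ) - N) * (f k : ℤ)) := by
  have hrefl : ∑ k ∈ range (N + 1), ((2 * (k : ℤ) - N) * (f k : ℤ)) =
      ∑ k ∈ range (N + 1), ((2 * ((N - k : ℕ) : ℤ) - N) * (f (N - k) : ℤ)) := by
    rw [← sum_range_reflect (fun k => (2 * (k : ℤ) - N) * (f k : ℤ)) (N + 1)]
    apply sum_congr rfl
    intro k hk
    rw [mem_range] at hk
    rw [show N + 1 - 1 - k = N - k by omega]
  have h2 : 2 * ∑ k ∈ range (N + 1), ((2 * (k : ℤ) - N) * (f k : ℤ)) =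
      ∑ k ∈ range (N + 1), ((2 * (k : ℤ) - N) * ((f k : ℤ) - (f (N - k) : ℤ))) := by
    rw [two_mul]
    nth_rewrite 2 [hrefl]
    rw [← sum_add_distrib]
    apply sum_congr rfl
    intro k hk
    rw [mem_range] at hk
    have hcast : ((N - k : ℕ) : ℤ) = (N : ℤ) - (k : ℤ) := by
      rw [Nat.cast_sub (by omega)]
    rw [hcast]
    ring
  have h3 : 0 ≤ ∑ k ∈ range (N + 1), ((2 * (k : ℤ) - N) * ((f k : ℤ) - (f (N - k) : ℤ))) := by
    apply sum_nonneg
    intro k hk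
    rw [mem_range] at hk
    rcases lt_trichotomy (2 * k) N with hlt | heq | hgt
    · have := hf k hlt
      apply mul_nonneg_of_nonpos_of_nonpos
      · have : ((2 * k : ℕ) : ℤ) < (N : ℤ) := by exact_mod_cast hlt
        push_cast at this
        linarith
      · have : (f k : ℤ) ≤ (f (N - k) : ℤ) := by exact_mod_cast this
        linarith
    · have : (2 * (k : ℤ) - N) = 0 := by
        have : ((2 * k : ℕ) : ℤ) = (N : ℤ) := by exact_mod_cast heq
        push_cast at this
        linarith
      rw [this, zero_mul]
    · have hk' : 2 * (N - k) < N := by omega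
      have := hf (N - k) hk'
      rw [show N - (N - k) = k by omega] at this
      apply mul_nonneg
      · have : (N : ℤ) < ((2 * k : ℕ) : ℤ) := by exact_mod_cast hgt
        push_cast at this
        linarith
      · have : (f (N - k) : ℤ) ≤ (f k : ℤ) := by exact_mod_cast this
        linarith
  linarith

/-- **(SYM) ⟹ (C1′)**: pairing each level `k < N/2` with its mirror `N − k`, the signed first moment
`Σ_k (2k − N) κ_k` is a sum of non-negative terms. -/
theorem capLimit_of_capSym (h : CapSym α) : CapLimit α := by
  intro M _ p hp
  have h1 := sum_mirror_nonneg (gr M).card (fun k => capCount M k p) (fun k hk => h M p k hp hk)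
  have h2 : ∑ k ∈ range ((gr M).card + 1), ((2 * (k : ℤ) - (gr M).card) * (capCount M k p : ℤ)) =
      2 * ((∑ k ∈ range ((gr M).card + 1), k * capCount M k p : ℕ) : ℤ) -
        ((gr M).card : ℤ) * ((∑ k ∈ range ((gr M).card + 1), capCount M k p : ℕ) : ℤ) := by
    push_cast
    rw [mul_sum, mul_sum, ← sum_sub_distrib]
    apply sum_congr rfl
    intro k _
    ring
  rw [h2] at h1
  have h3 : (((gr M).card * ∑ k ∈ range ((gr M).card + 1), capCount M k p : ℕ) : ℤ) ≤
      ((2 * ∑ k ∈ range ((gr M).card + 1), k * capCount M k p : ℕ) : ℤ) := by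
    push_cast
    push_cast at h1
    linarith
  exact_mod_cast h3

end PercRepro.Cogirth
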